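import Summits.BirchSwinnertonDyer.BirchSwinnertonDyer.Theorems.KolyvaginDepthDoorDepthTableRankTwo446d1TwistBSDQuotient
import HarnessLib

/-!
# Route `KolyvaginDepthDoor`, crux `KolyvaginDepthSupplyKN` (stmt-BirchSwinnertonDyer-22820) —
# DEPTH TABLE v15, the PREPRINT-FREE road for the row `446d1` at `(p, d_K) = (5, -23)`: W. ZHANG 2014 THM. 1.6 BY NAME
# (the `p`-part of BSD in analytic rank one for ANY conductor) in place of Burungale–Castella–Skinner 2025

Helper file of the lead prover of line `levelone` (kdd-p1 g19; `--supports stmt-BirchSwinnertonDyer-22820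
--as helper`); it closes nothing and BSD is NOT proved by it.

`KolyvaginDepthDoorDepthTableRankTwo446d1TwistBSDQuotient` reads the rank-one datum of this row through Burungale–Castella–Skinner 2025 Cor. 1.3.1. The cell's
literature desk books that corollary's proof chain with an unrefereed node and records W. Zhang, Camb. J. Math. 2 (2014) Thm. 1.6
(tree fact `WZhang2014_padicValRat_bsd_rank_one_ordinary`) as the preprint-free road («T-ZH14»). Zhang's Thm. 1.4 hypotheses hold
for the twist `T = 446d1^{(-23)}` (minimal model `T₀ = [1, -1, 0, -2215, -35567]`, `Δ(T₀) = 132048012988`, prime-power factorisation `2^2`, `23^6`, `223^1`):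
(1) `ρ̄_{T,5}` onto (`minTwist23_hasSurjectiveModNGaloisRep_5`); (4) `5` good ordinary; (2)–(3): `T` is NOT semistable
(additive at the primes of `d_K`), its multiplicative primes are EXACTLY `2` and `223` (`v = 2, 1`, both prime to `5`), so
`Ram(ρ̄_{T,5}) = {2, 223}` has two elements and the parity clause of (3) is vacuous — certified below from the integer
model (`minTwist23_spadeOne_5`: `5 ∤ v_ℓ(Δ_T)` at EVERY multiplicative `ℓ`, by the factorisation; `minTwist23_zhangThree_5`).

* `minTwist23_natCard_selmerGroup_eq_of_bsdQuotient_zhang` — **W. Zhang 2014 Thm. 1.6 + GZK ⟹ the datum**: `ord_{s=1} L(T,s) = 1` and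
  `ord_5(L'(T,1)/(Reg_T·Ω_T)) ≤ 0` ⟹ `#Sel_5(T/ℚ) = 5` (generic `natCard_selmerGroup_eq_of_rankOne_bsdQuotient_zhang`; the torsion
  term of Zhang's identity vanishes because `T[5]` is irreducible).
* `natCard_selmerGroup_quadraticTwist_neg23_eq_of_bsdQuotient_zhang`, `cruxBody_of_twistBSDQuotient_zhang` — transport and the
  crux clause at `446d1`, exactly as in the BCS file.

CONDITIONAL on the named print facts; per curve; nothing class-wide (the open stub (S♭) is untouched); BSD is NOT proved by it.

References: [WZhang2014] Thm. 1.6 (p. 199), Thm. 1.4 (p. 197); [Darmon2004] Thm. 3.22; [SilvermanAEC2009] VII.5.1, VIII.8, X.4.2.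
-/

set_option linter.dupNamespace false

noncomputable section

open scoped Classical NumberField

namespace Summit.BirchSwinnertonDyer.BirchSwinnertonDyer.Theorems.KolyvaginDepthDoor

open Literature.NumberTheory.EllipticCurves Literature.NumberTheory.EllipticCurves.ModularForms
  WeierstrassCurve NumberField IsDedekindDomain
open Summit.BirchSwinnertonDyer.BirchSwinnertonDyer.Theorems
open Summit.BirchSwinnertonDyer.BirchSwinnertonDyer.Rank2Observatory
open Summit.BirchSwinnertonDyer.BirchSwinnertonDyer.Rank1Residual
open Summit.BirchSwinnertonDyer.Rank1Residual.Additive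

namespace C446d1

/-- **Zhang's (2), in full strength, for `T`: `5 ∤ v_ℓ(Δ_T)` at EVERY multiplicative prime `ℓ`** — a multiplicative `ℓ` divides
`N_T ∣ Δ(T₀) = 132048012988`, whose prime-power exponents (`2^2`, `23^6`, `223^1`) are all prime to `5` (tree lemma `not_dvd_padicValInt_of_intModel`, the
exponents supplied from the factorisation). [cite: WZhang2014, Thm. 1.4 (2) (p. 197)] [cite: SilvermanAEC2009, VII.5.1, VIII.8] -/
theorem minTwist23_spadeOne_5 :
    haveI := minTwist23_isElliptic; haveI := minTwist23_isGloballyMinimal;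
    haveI := Fact.mk (by norm_num : Nat.Prime 5);
    ∀ (ℓ : ℕ) [Fact ℓ.Prime], ((⟨1, -1, 0, -2215, -35567⟩ : WeierstrassCurve ℤ).map (Int.castRingHom ℚ)).HasMultiplicativeReductionAtPrime ℓ →
      ¬ 5 ∣ padicValInt ℓ ((⟨1, -1, 0, -2215, -35567⟩ : WeierstrassCurve ℤ).map (Int.castRingHom ℚ)).minimalDiscriminantInt := by
  haveI := minTwist23_isElliptic
  haveI := minTwist23_isGloballyMinimal
  haveI := Fact.mk (by norm_num : Nat.Prime 5)
  have hΔ : (⟨1, -1, 0, -2215, -35567⟩ : WeierstrassCurve ℤ).Δ = 132048012988 := by decide +kernel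
  refine not_dvd_padicValInt_of_intModel minTwist23_intModel 5 ?_
  rw [hΔ]
  exact (by
      intro q hqP hqd
      have hqd' : q ∣ (132048012988 : ℤ).natAbs := Int.natCast_dvd.mp hqd
      have hn : ((132048012988 : ℤ).natAbs) = 2 ^ 2 * (23 ^ 6 * (223 ^ 1)) := by norm_num
      rw [hn] at hqd'
      rcases (Nat.Prime.dvd_mul hqP).mp hqd' with h | h0
      · obtain rfl := (Nat.prime_dvd_prime_iff_eq hqP (by norm_num)).mp (hqP.dvd_of_dvd_pow h)
        exact ⟨2, by decide +kernel, by decide +kernel, by norm_num⟩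
      · rcases (Nat.Prime.dvd_mul hqP).mp h0 with h | h1
        · obtain rfl := (Nat.prime_dvd_prime_iff_eq hqP (by norm_num)).mp (hqP.dvd_of_dvd_pow h)
          exact ⟨6, by decide +kernel, by decide +kernel, by norm_num⟩
        · obtain rfl := (Nat.prime_dvd_prime_iff_eq hqP (by norm_num)).mp (hqP.dvd_of_dvd_pow h1)
          exact ⟨1, by decide +kernel, by decide +kernel, by norm_num⟩
      )

/-- **Zhang's (3) for `T`**: `T` has the two multiplicative primes `2` (`v = 2`) and `223` (`v = 1`), both in `Ram(ρ̄_{T,5})`, so the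
set `Ram` is not a singleton and the parity clause is vacuous; the existence clause is witnessed by `2`.
[cite: WZhang2014, Thm. 1.4 (3) (p. 197)] [cite: SilvermanAEC2009, VII.5 Prop. 5.1 (b)] -/
theorem minTwist23_zhangThree_5 :
    haveI := minTwist23_isElliptic; haveI := minTwist23_isGloballyMinimal;
    ¬ ((⟨1, -1, 0, -2215, -35567⟩ : WeierstrassCurve ℤ).map (Int.castRingHom ℚ)).IsSemistable ℤ →
      (∃ ℓ : ℕ, ∃ _ : Fact ℓ.Prime, ((⟨1, -1, 0, -2215, -35567⟩ : WeierstrassCurve ℤ).map (Int.castRingHom ℚ)).HasMultiplicativeReductionAtPrime ℓ ∧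
          ¬ 5 ∣ padicValInt ℓ ((⟨1, -1, 0, -2215, -35567⟩ : WeierstrassCurve ℤ).map (Int.castRingHom ℚ)).minimalDiscriminantInt) ∧
        (Set.ncard {ℓ : ℕ | ∃ _ : Fact ℓ.Prime, ((⟨1, -1, 0, -2215, -35567⟩ : WeierstrassCurve ℤ).map (Int.castRingHom ℚ)).HasMultiplicativeReductionAtPrime ℓ ∧
            ¬ 5 ∣ padicValInt ℓ ((⟨1, -1, 0, -2215, -35567⟩ : WeierstrassCurve ℤ).map (Int.castRingHom ℚ)).minimalDiscriminantInt} = 1 →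
          Even (Set.ncard {ℓ : ℕ | ∃ _ : Fact ℓ.Prime, ((⟨1, -1, 0, -2215, -35567⟩ : WeierstrassCurve ℤ).map (Int.castRingHom ℚ)).HasMultiplicativeReductionAtPrime ℓ})) := by
  haveI := minTwist23_isElliptic
  haveI := minTwist23_isGloballyMinimal
  haveI i1 := Fact.mk (by norm_num : Nat.Prime 2)
  haveI i2 := Fact.mk (by norm_num : Nat.Prime 223)
  haveI := Fact.mk (by norm_num : Nat.Prime 5)
  intro _
  have hm1 : ((⟨1, -1, 0, -2215, -35567⟩ : WeierstrassCurve ℤ).map (Int.castRingHom ℚ)).HasMultiplicativeReductionAtPrime 2 :=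
    IntModel.hasMultiplicativeReductionAtPrime_of_intModel minTwist23_intModel 2 (by decide +kernel) (by decide +kernel)
  have hm2 : ((⟨1, -1, 0, -2215, -35567⟩ : WeierstrassCurve ℤ).map (Int.castRingHom ℚ)).HasMultiplicativeReductionAtPrime 223 :=
    IntModel.hasMultiplicativeReductionAtPrime_of_intModel minTwist23_intModel 223 (by decide +kernel) (by decide +kernel)
  have hv1 : ¬ 5 ∣ padicValInt 2 ((⟨1, -1, 0, -2215, -35567⟩ : WeierstrassCurve ℤ).map (Int.castRingHom ℚ)).minimalDiscriminantInt := minTwist23_spadeOne_5 2 hm1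
  have hv2 : ¬ 5 ∣ padicValInt 223 ((⟨1, -1, 0, -2215, -35567⟩ : WeierstrassCurve ℤ).map (Int.castRingHom ℚ)).minimalDiscriminantInt := minTwist23_spadeOne_5 223 hm2
  refine ⟨⟨2, i1, hm1, hv1⟩, fun h1 => ?_⟩
  exfalso
  obtain ⟨a, ha⟩ := Set.ncard_eq_one.mp h1
  have e1 : (2 : ℕ) = a := by
    have : (2 : ℕ) ∈ ({a} : Set ℕ) := ha ▸ ⟨i1, hm1, hv1⟩
    simpa using this
  have e2 : (223 : ℕ) = a := by
    have : (223 : ℕ) ∈ ({a} : Set ℕ) := ha ▸ ⟨i2, hm2, hv2⟩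
    simpa using this
  omega

/-! ## The rank-one datum via W. Zhang 2014 Thm. 1.6 (preprint-free) -/

/-- **THE RANK-ONE DATUM OF THE `446d1` ROW AT `d_K = -23` VIA W. ZHANG 2014 THM. 1.6 + GZK (by name).** For `T = 446d1^{(-23)}`:
IF `ord_{s=1} L(T,s) = 1` and `ord_5(L'(T,1)/(Reg_T·Ω_T)) ≤ 0`, THEN `#Sel_5(T/ℚ) = 5` (generic
`natCard_selmerGroup_eq_of_rankOne_bsdQuotient_zhang` at the certificates: good ordinary `5`, `ρ̄_{T,5}` onto, Zhang's (2)–(3)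
`minTwist23_spadeOne_5` / `minTwist23_zhangThree_5`, Kodaira–Néron). CONDITIONAL on the two named facts; per curve; BSD is not proved
by it. [cite: WZhang2014, Thm. 1.6 (p. 199), Thm. 1.4 (p. 197)] [cite: Darmon2004, Thm. 3.22] [cite: SilvermanAEC2009, Thm. X.4.2] -/
theorem minTwist23_natCard_selmerGroup_eq_of_bsdQuotient_zhang
    (hWZ : WZhang2014_padicValRat_bsd_rank_one_ordinary) (hGZK : rank_eq_analyticRank_of_analyticRank_le_one)
    (hr : haveI := minTwist23_isElliptic;
      ((⟨1, -1, 0, -2215, -35567⟩ : WeierstrassCurve ℤ).map (Int.castRingHom ℚ)).analyticRank = 1)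
    (hval : haveI := minTwist23_isElliptic; haveI := minTwist23_isGloballyMinimal;
      ∀ q : ℚ, ((⟨1, -1, 0, -2215, -35567⟩ : WeierstrassCurve ℤ).map (Int.castRingHom ℚ)).leadingLCoeff /
          (((((⟨1, -1, 0, -2215, -35567⟩ : WeierstrassCurve ℤ).map (Int.castRingHom ℚ)).regulator : ℂ)) *
            ((((⟨1, -1, 0, -2215, -35567⟩ : WeierstrassCurve ℤ).map (Int.castRingHom ℚ)).realPeriodRat : ℂ))) = (q : ℂ) →
        padicValRat 5 q ≤ 0) :
    haveI := minTwist23_isElliptic;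
    Nat.card (((⟨1, -1, 0, -2215, -35567⟩ : WeierstrassCurve ℤ).map (Int.castRingHom ℚ)).selmerGroup (5 : ℕ)) = 5 := by
  haveI := minTwist23_isElliptic
  haveI := minTwist23_isGloballyMinimal
  haveI := Fact.mk (by norm_num : Nat.Prime 5)
  exact natCard_selmerGroup_eq_of_rankOne_bsdQuotient_zhang hWZ hGZK _ 5 (by norm_num)
    minTwist23_goodOrdinary_5.1 minTwist23_goodOrdinary_5.2 minTwist23_hasSurjectiveModNGaloisRep_5
    (fun ℓ _ hm _ => minTwist23_spadeOne_5 ℓ hm) minTwist23_zhangThree_5 minTwist23_kodairaNeron_5 hr hval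

/-- **The same datum on `E.quadraticTwist (-23)`** (`E = 446d1`), Zhang road, transported along `minTwist23_smul_eq`. CONDITIONAL on
W. Zhang 2014 Thm. 1.6 and GZK by name; per curve; BSD is not proved by it. [cite: WZhang2014, Thm. 1.6 (p. 199)] [cite: Darmon2004, Thm. 3.22] -/
theorem natCard_selmerGroup_quadraticTwist_neg23_eq_of_bsdQuotient_zhang
    (hWZ : WZhang2014_padicValRat_bsd_rank_one_ordinary) (hGZK : rank_eq_analyticRank_of_analyticRank_le_one)
    (hr : haveI := minTwist23_isElliptic;
      ((⟨1, -1, 0, -2215, -35567⟩ : WeierstrassCurve ℤ).map (Int.castRingHom ℚ)).analyticRank = 1)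
    (hval : haveI := minTwist23_isElliptic; haveI := minTwist23_isGloballyMinimal;
      ∀ q : ℚ, ((⟨1, -1, 0, -2215, -35567⟩ : WeierstrassCurve ℤ).map (Int.castRingHom ℚ)).leadingLCoeff /
          (((((⟨1, -1, 0, -2215, -35567⟩ : WeierstrassCurve ℤ).map (Int.castRingHom ℚ)).regulator : ℂ)) *
            ((((⟨1, -1, 0, -2215, -35567⟩ : WeierstrassCurve ℤ).map (Int.castRingHom ℚ)).realPeriodRat : ℂ))) = (q : ℂ) →
        padicValRat 5 q ≤ 0) :
    haveI := isElliptic_c446d1;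
    haveI := isGloballyMinimal_c446d1;
    Nat.card ((((⟨1, -1, 0, -4, 4⟩ : WeierstrassCurve ℤ).map (Int.castRingHom ℚ)).quadraticTwist ((-23) : ℚ)).selmerGroup (5 : ℕ)) = 5 := by
  haveI := isElliptic_c446d1
  haveI := isGloballyMinimal_c446d1
  rw [← natCard_selmerGroup_eq_of_variableChange ((5 : ℕ) : ℤ) minTwist23_smul_eq]
  exact minTwist23_natCard_selmerGroup_eq_of_bsdQuotient_zhang hWZ hGZK hr hval

/-- **THE CRUX `KolyvaginDepthSupplyKN` AT `446d1`, MODULO PRINT AND ONE BSD-QUOTIENT VALUATION — preprint-free road.** As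
`cruxBody_of_twistBSDQuotient` of the BCS file, with W. Zhang 2014 Thm. 1.6 in place of Burungale–Castella–Skinner 2025 Cor. 1.3.1.
CONDITIONAL on the named facts (Stein–Wuthrich 2013 Thm. 1.1, (γ) = Gross 1991 Prop. 3.7 (2), W. Zhang 2014 Lemma 8.4 (1) / Thm. 9.1; W. Zhang 2014 Thm. 1.6; GZK) and the two rank-one hypotheses; per curve (the open stub (S♭)
is untouched); BSD is not proved by it. [cite: SteinWuthrich2013, Thm. 1.1 (p. 1758)] [cite: WZhang2014, Lemma 8.4 (1) (p. 236), Thm. 9.1 (p. 240)] [cite: GrossLMS1991, Prop. 3.7 (2)] [cite: WZhang2014, Thm. 1.6 (p. 199)] [cite: Darmon2004, Thm. 3.22] -/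
theorem cruxBody_of_twistBSDQuotient_zhang
    (hSW : SteinWuthrich2013_sha_inf_torsionBy_eq_bot_of_two_le_rank)
    (h372 : GrossLMS1991.prop37_2_frobeniusCongruence)
    (h84 : Literature.NumberTheory.EllipticCurves.WZhang2014_lemma84_exists_minimal_kolyvaginClass_one_selmerCard)
    (hWZ : WZhang2014_padicValRat_bsd_rank_one_ordinary) (hGZK : rank_eq_analyticRank_of_analyticRank_le_one)
    (K : Type) [Field K] [NumberField K] (hK : IsImaginaryQuadratic K) (hD : NumberField.discr K = -23)
    (hr : haveI := minTwist23_isElliptic;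
      ((⟨1, -1, 0, -2215, -35567⟩ : WeierstrassCurve ℤ).map (Int.castRingHom ℚ)).analyticRank = 1)
    (hval : haveI := minTwist23_isElliptic; haveI := minTwist23_isGloballyMinimal;
      ∀ q : ℚ, ((⟨1, -1, 0, -2215, -35567⟩ : WeierstrassCurve ℤ).map (Int.castRingHom ℚ)).leadingLCoeff /
          (((((⟨1, -1, 0, -2215, -35567⟩ : WeierstrassCurve ℤ).map (Int.castRingHom ℚ)).regulator : ℂ)) *
            ((((⟨1, -1, 0, -2215, -35567⟩ : WeierstrassCurve ℤ).map (Int.castRingHom ℚ)).realPeriodRat : ℂ))) = (q : ℂ) →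
        padicValRat 5 q ≤ 0) :
    haveI := isElliptic_c446d1;
    haveI := isGloballyMinimal_c446d1;
    ∃ (p : ℕ) (hp : Fact p.Prime), 5 ≤ p ∧ ((⟨1, -1, 0, -4, 4⟩ : WeierstrassCurve ℤ).map (Int.castRingHom ℚ)).HasGoodReductionAtPrime p ∧
      ¬ (p : ℤ) ∣ ((⟨1, -1, 0, -4, 4⟩ : WeierstrassCurve ℤ).map (Int.castRingHom ℚ)).frobeniusTrace p ∧ (∀ n : ℕ, ((⟨1, -1, 0, -4, 4⟩ : WeierstrassCurve ℤ).map (Int.castRingHom ℚ)).HasSurjectiveModNGaloisRep (p ^ n : ℕ)) ∧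
      (∀ v : HeightOneSpectrum (𝓞 ℚ), ((⟨1, -1, 0, -4, 4⟩ : WeierstrassCurve ℤ).map (Int.castRingHom ℚ)).HasMultiplicativeReductionAt v →
        ¬ p ∣ ((⟨1, -1, 0, -4, 4⟩ : WeierstrassCurve ℤ).map (Int.castRingHom ℚ)).ordMinimalDiscriminant v) ∧
      ∃ (K : Type) (_ : Field K) (_ : NumberField K), IsImaginaryQuadratic K ∧
        NumberField.discr K ≠ -3 ∧ NumberField.discr K ≠ -4 ∧
        ∃ (_ : NeZero (((⟨1, -1, 0, -4, 4⟩ : WeierstrassCurve ℤ).map (Int.castRingHom ℚ)).conductorNorm ℤ)), SatisfiesHeegnerHypothesis (((⟨1, -1, 0, -4, 4⟩ : WeierstrassCurve ℤ).map (Int.castRingHom ℚ)).conductorNorm ℤ) K ∧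
        ∃ (Dt : ModularParametrizationData ((⟨1, -1, 0, -4, 4⟩ : WeierstrassCurve ℤ).map (Int.castRingHom ℚ)) (((⟨1, -1, 0, -4, 4⟩ : WeierstrassCurve ℤ).map (Int.castRingHom ℚ)).conductorNorm ℤ)) (β : ℤ) (ι : K →+* ℂ) (n₁ : ℕ)
          (d : KolyvaginHeegnerData Dt β ι n₁), Squarefree n₁ ∧
          (∀ q ∈ n₁.primeFactors, Zhang2014.IsKolyvaginPrime (((⟨1, -1, 0, -4, 4⟩ : WeierstrassCurve ℤ).map (Int.castRingHom ℚ)).conductorNorm ℤ) ((⟨1, -1, 0, -4, 4⟩ : WeierstrassCurve ℤ).map (Int.castRingHom ℚ)) K p q) ∧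
          d.kolyvaginClass hp.out 1 ≠ 0 ∧
          (n₁.primeFactors.card + 1 ≤ ((⟨1, -1, 0, -4, 4⟩ : WeierstrassCurve ℤ).map (Int.castRingHom ℚ)).mordellWeilRank ∨
            (n₁.primeFactors.card ≤ ((⟨1, -1, 0, -4, 4⟩ : WeierstrassCurve ℤ).map (Int.castRingHom ℚ)).mordellWeilRank ∧
              n₁.primeFactors.card + 1 ≤ (((⟨1, -1, 0, -4, 4⟩ : WeierstrassCurve ℤ).map (Int.castRingHom ℚ)).quadraticTwist (NumberField.discr K : ℚ)).mordellWeilRank)) := by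
  haveI := isElliptic_c446d1
  haveI := isGloballyMinimal_c446d1
  have h1 := natCard_selmerGroup_quadraticTwist_neg23_eq_of_bsdQuotient_zhang hWZ hGZK hr hval
  refine cruxBody_of_twistSelmer hSW h372 h84 K hK hD ?_
  have hcast : (NumberField.discr K : ℚ) = ((-23) : ℚ) := by rw [hD]; norm_num
  rw [hcast, h1]

end C446d1

end Summit.BirchSwinnertonDyer.BirchSwinnertonDyer.Theorems.KolyvaginDepthDoor

end
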